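import Mathlib.LinearAlgebra.Matrix.NonsingularInverse
import Mathlib.LinearAlgebra.FiniteDimensional.Lemmas
import Mathlib.LinearAlgebra.LinearIndependent.Lemmas
import Mathlib.Data.ZMod.Basic
import Mathlib.FieldTheory.Finite.Basic
import Literature.Computability.QuantumComplexity.IQPForrelation

/-!
# Crux `CubicForrelation.NearExactIsExact` (stmt-QuantumAdvantage-14043) — EXISTENCE OF ADAPTED FRAMES (linear algebra over `𝔽₂`)

Certificate seat `b2b-cforr-cert` (gen 40).  HONEST FRAMING: kernel-checked linear algebra (standard axioms), the "(L4) frames" input of the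
Lean roadmap for `E1280-even` (HOME/b2b-cforr-cert-g39/E1280-HANDPROOFS.md §3).  Nothing about `θ₁₂`; NOT summit progress.

`tow_R2_frame` (…TwelveOddWeightR2) describes a rank-2 derivative of a cubic `κ` on bit vectors: a direction `a ≠ 0` and two independent
parity forms `z₀, z₁` with `⟨a,z₀⟩ = ⟨a,z₁⟩ = 0` such that `D_aκ` is the indicator of `{⟨x,z₀⟩ = b₀, ⟨x,z₁⟩ = b₁}`.  To analyse `κ` in the
coordinates `(y₀, y₁, y₂, s)` of …CubicFormCells one needs an INVERTIBLE matrix `P` over `𝔽₂` (acting on bit vectors by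
`(P y)_ψ = [Σ_φ P_{ψφ} y_φ = 1]`, as in …CubicFormTransport) whose `0`-th column is `a` and which pulls the two parity forms back to the
coordinate forms `y₁, y₂`.
* `tcr_extend`: a linearly independent family `Fin k → 𝔽₂ᴺ` extends to a linearly independent family `Fin (k + j) → 𝔽₂ᴺ` (`k + j ≤ N`)
  keeping the first `k` vectors (`exists_linearIndependent_snoc_of_lt_finrank`, iterated).
* `tcr_dual_pair`: for parity forms `z₀ ≠ z₁`, both non-zero, there are vectors `u₁, u₂` with `⟨u_s, z_t⟩ = [s = t]`.
* `tcr_parity_eq_decide_sum`: the tree's parity `Odd #{j : x_j ∧ z_j}` is the `𝔽₂` dot product.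
* `tcr_adapted_frame` (**main**): given `a ≠ 0` and such `z₀, z₁` with `⟨a,z₀⟩ = ⟨a,z₁⟩ = 0` on `3 + m` bits, there are `P, Pi` with
  `P Pi = Pi P = 1`, column `0` of `P` equal to `a`, and `⟨P y, z₀⟩ = y₁`, `⟨P y, z₁⟩ = y₂` for every bit vector `y`.

References: folklore linear algebra; F. J. MacWilliams, N. J. A. Sloane (1977) Ch. 13 §4 (adapted coordinates for a derivative).
Axioms: the standard three.
-/

set_option linter.dupNamespace false -- D-0017: single-problem summit ⇒ `QuantumAdvantage.QuantumAdvantage` by design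

namespace Summit.QuantumAdvantage.QuantumAdvantage.Theorems.CubicForrelation.NearExactIsExact

open Finset Module
open Literature.Computability.QuantumComplexity.BuzetChailloux (zeroVec)

/-! ### Extending a linearly independent family -/

/-- **Extension of an independent family.**  A linearly independent `v : Fin k → 𝔽₂ᴺ` extends, for `k + j ≤ N`, to a linearly independent
`w : Fin (k + j) → 𝔽₂ᴺ` with `w (castAdd j i) = v i`. [folklore] -/
theorem tcr_extend {N k : ℕ} (v : Fin k → (Fin N → ZMod 2)) (hv : LinearIndependent (ZMod 2) v) (j : ℕ) (h : k + j ≤ N) :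
    ∃ w : Fin (k + j) → (Fin N → ZMod 2), LinearIndependent (ZMod 2) w ∧ ∀ i, w (Fin.castAdd j i) = v i := by
  induction j with
  | zero => exact ⟨v, hv, fun i => rfl⟩
  | succ j ih =>
    obtain ⟨w, hw, hwv⟩ := ih (by omega)
    have hlt : k + j < finrank (ZMod 2) (Fin N → ZMod 2) := by rw [finrank_fin_fun]; omega
    obtain ⟨x, hx⟩ := exists_linearIndependent_snoc_of_lt_finrank hw hlt
    refine ⟨Fin.snoc w x, hx, fun i => ?_⟩
    have hc : (Fin.castAdd (j + 1) i : Fin (k + j + 1)) = (Fin.castAdd j i).castSucc := (Fin.castSucc_castAdd i).symm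
    rw [hc, Fin.snoc_castSucc]
    exact hwv i

/-! ### Parity forms as `𝔽₂` dot products -/

/-- The tree's parity `Odd #{j : x_j ∧ z_j}` read as a dot product in `𝔽₂`. [folklore] -/
theorem tcr_parity_eq_decide_sum {N : ℕ} (x z : Fin N → Bool) :
    decide (Odd #(univ.filter fun j => x j && z j)) =
      decide ((∑ j, (if x j = true then (1 : ZMod 2) else 0) * (if z j = true then (1 : ZMod 2) else 0)) = 1) := by
  have hs : (∑ j, (if x j = true then (1 : ZMod 2) else 0) * (if z j = true then (1 : ZMod 2) else 0)) =
      ((#(univ.filter fun j => x j && z j) : ℕ) : ZMod 2) := by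
    rw [Finset.natCast_card_filter]
    refine sum_congr rfl fun j _ => ?_
    cases x j <;> cases z j <;> simp
  refine (decide_eq_decide.mpr ?_)
  rw [hs, ZMod.natCast_eq_one_iff_odd]

/-- A dual pair of vectors for two distinct non-zero parity forms: `⟨u₁,z₀⟩ = 1, ⟨u₁,z₁⟩ = 0, ⟨u₂,z₀⟩ = 0, ⟨u₂,z₁⟩ = 1` (in `𝔽₂`).
[folklore] -/
theorem tcr_dual_pair {N : ℕ} (z₀ z₁ : Fin N → Bool) (hz₀ : z₀ ≠ zeroVec) (hz₁ : z₁ ≠ zeroVec) (hz : z₀ ≠ z₁) :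
    ∃ u₁ u₂ : Fin N → ZMod 2,
      (∑ j, u₁ j * (if z₀ j = true then (1 : ZMod 2) else 0)) = 1 ∧ (∑ j, u₁ j * (if z₁ j = true then (1 : ZMod 2) else 0)) = 0 ∧
      (∑ j, u₂ j * (if z₀ j = true then (1 : ZMod 2) else 0)) = 0 ∧ (∑ j, u₂ j * (if z₁ j = true then (1 : ZMod 2) else 0)) = 1 := by
  classical
  -- unit vectors evaluate the forms at a coordinate
  have hunit : ∀ (z : Fin N → Bool) (j₀ : Fin N),
      (∑ j, (if j = j₀ then (1 : ZMod 2) else 0) * (if z j = true then (1 : ZMod 2) else 0)) = if z j₀ = true then 1 else 0 := by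
    intro z j₀
    simp only [ite_mul, one_mul, zero_mul, sum_ite_eq', mem_univ, if_true]
  -- a coordinate where the two forms differ, and coordinates where each is `1`
  obtain ⟨j, hj⟩ : ∃ j, z₀ j ≠ z₁ j := by
    by_contra hno
    push Not at hno
    exact hz (funext hno)
  have hex : ∀ z : Fin N → Bool, z ≠ zeroVec → ∃ i, z i = true := by
    intro z hzz
    by_contra hno
    push Not at hno
    exact hzz (funext fun i => by simpa [zeroVec] using hno i)
  -- generic construction: from `e` with `⟨e,z⟩ = 1, ⟨e,z'⟩ = 0` and `z' ≠ 0` get the pair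
  have build : ∀ (z z' : Fin N → Bool) (e : Fin N → ZMod 2), z' ≠ zeroVec →
      (∑ j, e j * (if z j = true then (1 : ZMod 2) else 0)) = 1 → (∑ j, e j * (if z' j = true then (1 : ZMod 2) else 0)) = 0 →
      ∃ u : Fin N → ZMod 2,
        (∑ j, u j * (if z j = true then (1 : ZMod 2) else 0)) = 0 ∧ (∑ j, u j * (if z' j = true then (1 : ZMod 2) else 0)) = 1 := by
    intro z z' e hz' he1 he0
    obtain ⟨i, hi⟩ := hex z' hz'
    refine ⟨fun j => (if j = i then (1 : ZMod 2) else 0) + (if z i = true then (1 : ZMod 2) else 0) * e j, ?_, ?_⟩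
    · simp only [add_mul, sum_add_distrib, hunit, mul_assoc, ← mul_sum, he1, mul_one]
      exact CharTwo.add_self_eq_zero _
    · simp only [add_mul, sum_add_distrib, hunit, mul_assoc, ← mul_sum, he0, mul_zero, add_zero, hi, if_true]
  by_cases h0 : z₀ j = true
  · have h1 : z₁ j = false := by
      cases h : z₁ j
      · rfl
      · exact absurd (h0.trans h.symm) hj
    have e1 : (∑ j', (if j' = j then (1 : ZMod 2) else 0) * (if z₀ j' = true then (1 : ZMod 2) else 0)) = 1 := by rw [hunit, if_pos h0]
    have e0 : (∑ j', (if j' = j then (1 : ZMod 2) else 0) * (if z₁ j' = true then (1 : ZMod 2) else 0)) = 0 := by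
      rw [hunit, h1]; rfl
    obtain ⟨u₂, hu₂0, hu₂1⟩ := build z₀ z₁ _ hz₁ e1 e0
    exact ⟨_, u₂, e1, e0, hu₂0, hu₂1⟩
  · have h0' : z₀ j = false := by cases h : z₀ j <;> simp_all
    have h1 : z₁ j = true := by
      cases h : z₁ j
      · exact absurd (h0'.trans h.symm) hj
      · rfl
    have e1 : (∑ j', (if j' = j then (1 : ZMod 2) else 0) * (if z₁ j' = true then (1 : ZMod 2) else 0)) = 1 := by rw [hunit, if_pos h1]
    have e0 : (∑ j', (if j' = j then (1 : ZMod 2) else 0) * (if z₀ j' = true then (1 : ZMod 2) else 0)) = 0 := by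
      rw [hunit, h0']; rfl
    obtain ⟨u₁, hu₁0, hu₁1⟩ := build z₁ z₀ _ hz₀ e1 e0
    exact ⟨u₁, _, hu₁1, hu₁0, e0, e1⟩

/-! ### The adapted frame -/

/-- **Existence of an adapted frame.**  On `3 + m` bits let `a ≠ 0` be a direction and `z₀ ≠ z₁` non-zero parity forms with
`⟨a,z₀⟩ = ⟨a,z₁⟩ = 0`.  Then there are matrices `P, Pi` over `𝔽₂` with `P Pi = Pi P = 1` such that the `0`-th column of `P` is `a` and, for
every bit vector `y`, the vector `P y` (`(P y)_ψ = [Σ_φ P_{ψφ} y_φ = 1]`) satisfies `⟨P y, z₀⟩ = y₁` and `⟨P y, z₁⟩ = y₂`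
(coordinates `0, 1, 2 = Fin.castAdd m 0, 1, 2`).  [folklore] -/
theorem tcr_adapted_frame {m : ℕ} (a z₀ z₁ : Fin (3 + m) → Bool) (ha : a ≠ zeroVec) (hz₀ : z₀ ≠ zeroVec) (hz₁ : z₁ ≠ zeroVec)
    (hz : z₀ ≠ z₁) (ha₀ : decide (Odd #(univ.filter fun j => a j && z₀ j)) = false)
    (ha₁ : decide (Odd #(univ.filter fun j => a j && z₁ j)) = false) :
    ∃ P Pi : Fin (3 + m) → Fin (3 + m) → ZMod 2,
      (∀ ψ ω, (∑ φ, P ψ φ * Pi φ ω) = if ψ = ω then 1 else 0) ∧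
      (∀ ψ ω, (∑ φ, Pi ψ φ * P φ ω) = if ψ = ω then 1 else 0) ∧
      (∀ ψ, P ψ (Fin.castAdd m (0 : Fin 3)) = if a ψ = true then 1 else 0) ∧
      (∀ y : Fin (3 + m) → Bool,
        decide (Odd #(univ.filter fun j =>
          (fun ψ => decide ((∑ φ, P ψ φ * (if y φ = true then (1 : ZMod 2) else 0)) = 1)) j && z₀ j)) = y (Fin.castAdd m (1 : Fin 3))) ∧
      (∀ y : Fin (3 + m) → Bool,
        decide (Odd #(univ.filter fun j =>
          (fun ψ => decide ((∑ φ, P ψ φ * (if y φ = true then (1 : ZMod 2) else 0)) = 1)) j && z₁ j)) = y (Fin.castAdd m (2 : Fin 3))) := by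
  classical
  -- the two functionals
  set ζ₀ : Fin (3 + m) → ZMod 2 := fun j => if z₀ j = true then 1 else 0 with hζ₀
  set ζ₁ : Fin (3 + m) → ZMod 2 := fun j => if z₁ j = true then 1 else 0 with hζ₁
  set f₀ : (Fin (3 + m) → ZMod 2) → ZMod 2 := fun v => ∑ j, v j * ζ₀ j with hf₀
  set f₁ : (Fin (3 + m) → ZMod 2) → ZMod 2 := fun v => ∑ j, v j * ζ₁ j with hf₁
  have hlin : ∀ (ζ : Fin (3 + m) → ZMod 2) {ι : Type} [Fintype ι] (g : ι → ZMod 2) (b : ι → Fin (3 + m) → ZMod 2),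
      (∑ j, (∑ i, g i • b i) j * ζ j) = ∑ i, g i * ∑ j, b i j * ζ j := by
    intro ζ ι _ g b
    simp only [Finset.sum_apply, Pi.smul_apply, smul_eq_mul, sum_mul, mul_sum]
    rw [sum_comm]
    exact sum_congr rfl fun i _ => sum_congr rfl fun j _ => by ring
  -- the direction `a` as an `𝔽₂` vector; it is non-zero and killed by both functionals
  set a' : Fin (3 + m) → ZMod 2 := fun j => if a j = true then 1 else 0 with ha'
  have ha'0 : f₀ a' = 0 := by
    have h := tcr_parity_eq_decide_sum a z₀
    rw [ha₀] at h
    have : ∀ t : ZMod 2, false = decide (t = 1) → t = 0 := by decide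
    exact this _ h
  have ha'1 : f₁ a' = 0 := by
    have h := tcr_parity_eq_decide_sum a z₁
    rw [ha₁] at h
    have : ∀ t : ZMod 2, false = decide (t = 1) → t = 0 := by decide
    exact this _ h
  have ha'ne : a' ≠ 0 := by
    intro h
    apply ha
    funext j
    have := congrFun h j
    simp only [ha', Pi.zero_apply] at this
    cases hj : a j
    · rfl
    · rw [hj] at this; exact absurd this one_ne_zero
  -- the dual pair
  obtain ⟨u₁, u₂, hu₁0, hu₁1, hu₂0, hu₂1⟩ := tcr_dual_pair z₀ z₁ hz₀ hz₁ hz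
  -- `a', u₁, u₂` are independent
  have hli3 : LinearIndependent (ZMod 2) ![a', u₁, u₂] := by
    rw [Fintype.linearIndependent_iff]
    intro g hg
    have e0 := congrArg f₀ hg
    have e1 := congrArg f₁ hg
    simp only [hf₀, hf₁, hlin, Pi.zero_apply, zero_mul, sum_const_zero] at e0 e1
    rw [Fin.sum_univ_three] at e0 e1
    simp only [Matrix.cons_val_zero, Matrix.cons_val_one, Matrix.cons_val_two, Matrix.head_cons, Matrix.tail_cons] at e0 e1 hg
    have ha0' : (∑ j, a' j * ζ₀ j) = 0 := ha'0
    have ha1' : (∑ j, a' j * ζ₁ j) = 0 := ha'1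
    have hu₁0' : (∑ j, u₁ j * ζ₀ j) = 1 := hu₁0
    have hu₁1' : (∑ j, u₁ j * ζ₁ j) = 0 := hu₁1
    have hu₂0' : (∑ j, u₂ j * ζ₀ j) = 0 := hu₂0
    have hu₂1' : (∑ j, u₂ j * ζ₁ j) = 1 := hu₂1
    rw [ha0', hu₁0', hu₂0'] at e0
    rw [ha1', hu₁1', hu₂1'] at e1
    simp only [mul_zero, mul_one, zero_add, add_zero] at e0 e1
    rw [Fin.sum_univ_three] at hg
    simp only [Matrix.cons_val_zero, Matrix.cons_val_one, Matrix.cons_val_two, Matrix.head_cons, Matrix.tail_cons, e0, e1, zero_smul,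
      add_zero] at hg
    have g0 : g 0 = 0 := by
      by_contra hne
      have : ∀ t : ZMod 2, t ≠ 0 → t = 1 := by decide
      rw [this _ hne, one_smul] at hg
      exact ha'ne hg
    intro i
    fin_cases i
    · exact g0
    · exact e0
    · exact e1
  -- extend to an independent family of `3 + m` vectors and reduce the new vectors into `ker f₀ ∩ ker f₁`
  obtain ⟨w, hw, hwv⟩ := tcr_extend ![a', u₁, u₂] hli3 m le_rfl
  have hw0 : w (Fin.castAdd m 0) = a' := hwv 0
  have hw1 : w (Fin.castAdd m 1) = u₁ := hwv 1
  have hw2 : w (Fin.castAdd m 2) = u₂ := hwv 2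
  set b : Fin (3 + m) → Fin (3 + m) → ZMod 2 :=
    Fin.append ![a', u₁, u₂] (fun σ => w (Fin.natAdd 3 σ) + f₀ (w (Fin.natAdd 3 σ)) • u₁ + f₁ (w (Fin.natAdd 3 σ)) • u₂) with hb
  have hb0 : b (Fin.castAdd m 0) = a' := by rw [hb, Fin.append_left]; rfl
  have hb1 : b (Fin.castAdd m 1) = u₁ := by rw [hb, Fin.append_left]; rfl
  have hb2 : b (Fin.castAdd m 2) = u₂ := by rw [hb, Fin.append_left]; rfl
  have hbσ : ∀ σ, b (Fin.natAdd 3 σ) = w (Fin.natAdd 3 σ) + f₀ (w (Fin.natAdd 3 σ)) • u₁ + f₁ (w (Fin.natAdd 3 σ)) • u₂ := by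
    intro σ; rw [hb, Fin.append_right]
  -- values of the functionals on the frame
  have hf₀b : ∀ φ, f₀ (b φ) = if φ = Fin.castAdd m 1 then 1 else 0 := by
    intro φ
    refine Fin.addCases (fun t => ?_) (fun σ => ?_) φ
    · fin_cases t
      · show f₀ (b (Fin.castAdd m 0)) = if Fin.castAdd m (0 : Fin 3) = Fin.castAdd m 1 then 1 else 0
        rw [hb0, ha'0, if_neg]; intro h; exact absurd (Fin.castAdd_inj.mp h) (by decide)
      · show f₀ (b (Fin.castAdd m 1)) = if Fin.castAdd m (1 : Fin 3) = Fin.castAdd m 1 then 1 else 0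
        rw [hb1, if_pos rfl]; exact hu₁0
      · show f₀ (b (Fin.castAdd m 2)) = if Fin.castAdd m (2 : Fin 3) = Fin.castAdd m 1 then 1 else 0
        rw [hb2, if_neg]
        · exact hu₂0
        · intro h; exact absurd (Fin.castAdd_inj.mp h) (by decide)
    · rw [hbσ, if_neg]
      · show (∑ j, (w (Fin.natAdd 3 σ) + f₀ (w (Fin.natAdd 3 σ)) • u₁ + f₁ (w (Fin.natAdd 3 σ)) • u₂) j * ζ₀ j) = 0
        simp only [Pi.add_apply, Pi.smul_apply, smul_eq_mul, add_mul, sum_add_distrib, mul_assoc, ← mul_sum]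
        have e1 : (∑ j, u₁ j * ζ₀ j) = 1 := hu₁0
        have e2 : (∑ j, u₂ j * ζ₀ j) = 0 := hu₂0
        rw [e1, e2, mul_one, mul_zero, add_zero]
        change f₀ (w (Fin.natAdd 3 σ)) + f₀ (w (Fin.natAdd 3 σ)) = 0
        exact CharTwo.add_self_eq_zero _
      · intro h
        have := congrArg Fin.val h
        simp only [Fin.val_natAdd, Fin.val_castAdd] at this
        omega
  have hf₁b : ∀ φ, f₁ (b φ) = if φ = Fin.castAdd m 2 then 1 else 0 := by
    intro φ
    refine Fin.addCases (fun t => ?_) (fun σ => ?_) φ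
    · fin_cases t
      · show f₁ (b (Fin.castAdd m 0)) = if Fin.castAdd m (0 : Fin 3) = Fin.castAdd m 2 then 1 else 0
        rw [hb0, ha'1, if_neg]; intro h; exact absurd (Fin.castAdd_inj.mp h) (by decide)
      · show f₁ (b (Fin.castAdd m 1)) = if Fin.castAdd m (1 : Fin 3) = Fin.castAdd m 2 then 1 else 0
        rw [hb1, if_neg]
        · exact hu₁1
        · intro h; exact absurd (Fin.castAdd_inj.mp h) (by decide)
      · show f₁ (b (Fin.castAdd m 2)) = if Fin.castAdd m (2 : Fin 3) = Fin.castAdd m 2 then 1 else 0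
        rw [hb2, if_pos rfl]; exact hu₂1
    · rw [hbσ, if_neg]
      · show (∑ j, (w (Fin.natAdd 3 σ) + f₀ (w (Fin.natAdd 3 σ)) • u₁ + f₁ (w (Fin.natAdd 3 σ)) • u₂) j * ζ₁ j) = 0
        simp only [Pi.add_apply, Pi.smul_apply, smul_eq_mul, add_mul, sum_add_distrib, mul_assoc, ← mul_sum]
        have e1 : (∑ j, u₁ j * ζ₁ j) = 0 := hu₁1
        have e2 : (∑ j, u₂ j * ζ₁ j) = 1 := hu₂1
        rw [e1, e2, mul_one, mul_zero, add_zero]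
        change f₁ (w (Fin.natAdd 3 σ)) + f₁ (w (Fin.natAdd 3 σ)) = 0
        exact CharTwo.add_self_eq_zero _
      · intro h
        have := congrArg Fin.val h
        simp only [Fin.val_natAdd, Fin.val_castAdd] at this
        omega
  -- `b` is independent
  have hbli : LinearIndependent (ZMod 2) b := by
    rw [Fintype.linearIndependent_iff]
    intro g hg
    -- rewrite the combination of `b` as a combination of `w`
    set g' : Fin (3 + m) → ZMod 2 := Fin.append
      ![g (Fin.castAdd m 0), g (Fin.castAdd m 1) + ∑ σ, g (Fin.natAdd 3 σ) * f₀ (w (Fin.natAdd 3 σ)),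
        g (Fin.castAdd m 2) + ∑ σ, g (Fin.natAdd 3 σ) * f₁ (w (Fin.natAdd 3 σ))]
      (fun σ => g (Fin.natAdd 3 σ)) with hg'
    have hsum : (∑ φ, g φ • b φ) = ∑ φ, g' φ • w φ := by
      rw [Fin.sum_univ_add, Fin.sum_univ_add, Fin.sum_univ_three, Fin.sum_univ_three, hb0, hb1, hb2, hw0, hw1, hw2]
      simp only [hg', Fin.append_left, Fin.append_right, hbσ, Matrix.cons_val_zero, Matrix.cons_val_one,
        Matrix.cons_val_two, Matrix.head_cons, Matrix.tail_cons, smul_add, add_smul, sum_add_distrib, Finset.sum_smul, smul_smul]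
      abel
    rw [hsum] at hg
    have hz := (Fintype.linearIndependent_iff.mp hw) g' hg
    have gσ : ∀ σ, g (Fin.natAdd 3 σ) = 0 := fun σ => by
      have := hz (Fin.natAdd 3 σ); rwa [hg', Fin.append_right] at this
    have g0 : g (Fin.castAdd m 0) = 0 := by have := hz (Fin.castAdd m 0); rwa [hg', Fin.append_left] at this
    have g1 : g (Fin.castAdd m 1) = 0 := by
      have := hz (Fin.castAdd m 1); rw [hg', Fin.append_left] at this
      simpa [gσ] using this
    have g2 : g (Fin.castAdd m 2) = 0 := by
      have := hz (Fin.castAdd m 2); rw [hg', Fin.append_left] at this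
      simpa [gσ] using this
    intro φ
    refine Fin.addCases (fun t => ?_) (fun σ => gσ σ) φ
    fin_cases t
    · exact g0
    · exact g1
    · exact g2
  -- the matrix with columns `b` is invertible
  set P : Matrix (Fin (3 + m)) (Fin (3 + m)) (ZMod 2) := Matrix.of fun ψ φ => b φ ψ with hP
  have hcol : P.col = b := by
    funext φ ψ; rfl
  have hPu : IsUnit P := Matrix.linearIndependent_cols_iff_isUnit.mp (by rw [hcol]; exact hbli)
  have hdet : IsUnit P.det := (Matrix.isUnit_iff_isUnit_det P).mp hPu
  have hPPi : P * P⁻¹ = 1 := Matrix.mul_nonsing_inv P hdet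
  have hPiP : P⁻¹ * P = 1 := Matrix.nonsing_inv_mul P hdet
  refine ⟨fun ψ φ => P ψ φ, fun ψ φ => P⁻¹ ψ φ, fun ψ ω => ?_, fun ψ ω => ?_, fun ψ => ?_, fun y => ?_, fun y => ?_⟩
  · have := congrFun (congrFun hPPi ψ) ω
    rw [Matrix.mul_apply, Matrix.one_apply] at this
    exact this
  · have := congrFun (congrFun hPiP ψ) ω
    rw [Matrix.mul_apply, Matrix.one_apply] at this
    exact this
  · show b (Fin.castAdd m 0) ψ = _
    rw [hb0]
  · -- `⟨P y, z₀⟩ = Σ_φ y_φ f₀(b_φ) = y₁`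
    rw [tcr_parity_eq_decide_sum]
    have hread : ∀ t : ZMod 2, (if decide (t = 1) = true then (1 : ZMod 2) else 0) = t := by decide
    simp only [hread]
    have hval : (∑ j, (∑ φ, P j φ * (if y φ = true then (1 : ZMod 2) else 0)) * (if z₀ j = true then (1 : ZMod 2) else 0)) =
        if y (Fin.castAdd m (1 : Fin 3)) = true then 1 else 0 := by
      have h1 : ∀ j, (∑ φ, P j φ * (if y φ = true then (1 : ZMod 2) else 0)) =
          (∑ φ, (fun φ => if y φ = true then (1 : ZMod 2) else 0) φ • b φ) j := by
        intro j
        simp only [Finset.sum_apply, Pi.smul_apply, smul_eq_mul, hP, Matrix.of_apply]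
        exact sum_congr rfl fun φ _ => mul_comm _ _
      simp only [h1]
      have h2 := hlin ζ₀ (fun φ => if y φ = true then (1 : ZMod 2) else 0) b
      simp only [hζ₀] at h2
      rw [h2]
      have h3 : ∀ φ, (∑ j, b φ j * (if z₀ j = true then (1 : ZMod 2) else 0)) = if φ = Fin.castAdd m 1 then 1 else 0 := hf₀b
      rw [sum_congr rfl fun φ _ => by rw [h3 φ]]
      simp only [mul_ite, mul_one, mul_zero, sum_ite_eq', mem_univ, if_true]
    rw [hval]
    cases y (Fin.castAdd m (1 : Fin 3)) <;> decide
  · rw [tcr_parity_eq_decide_sum]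
    have hread : ∀ t : ZMod 2, (if decide (t = 1) = true then (1 : ZMod 2) else 0) = t := by decide
    simp only [hread]
    have hval : (∑ j, (∑ φ, P j φ * (if y φ = true then (1 : ZMod 2) else 0)) * (if z₁ j = true then (1 : ZMod 2) else 0)) =
        if y (Fin.castAdd m (2 : Fin 3)) = true then 1 else 0 := by
      have h1 : ∀ j, (∑ φ, P j φ * (if y φ = true then (1 : ZMod 2) else 0)) =
          (∑ φ, (fun φ => if y φ = true then (1 : ZMod 2) else 0) φ • b φ) j := by
        intro j
        simp only [Finset.sum_apply, Pi.smul_apply, smul_eq_mul, hP, Matrix.of_apply]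
        exact sum_congr rfl fun φ _ => mul_comm _ _
      simp only [h1]
      have h2 := hlin ζ₁ (fun φ => if y φ = true then (1 : ZMod 2) else 0) b
      simp only [hζ₁] at h2
      rw [h2]
      have h3 : ∀ φ, (∑ j, b φ j * (if z₁ j = true then (1 : ZMod 2) else 0)) = if φ = Fin.castAdd m 2 then 1 else 0 := hf₁b
      rw [sum_congr rfl fun φ _ => by rw [h3 φ]]
      simp only [mul_ite, mul_one, mul_zero, sum_ite_eq', mem_univ, if_true]
    rw [hval]
    cases y (Fin.castAdd m (2 : Fin 3)) <;> decide

end Summit.QuantumAdvantage.QuantumAdvantage.Theorems.CubicForrelation.NearExactIsExact
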